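import Summits.CriticalPhenomena.PercolationContinuityZ3.Theorems.FK.Transplant.FHSlabThresholdPeierls
import Summits.CriticalPhenomena.PercolationContinuityZ3.Theorems.FK.BernoulliComparison
import HarnessLib

/-!
# FRONTIER TRANSPLANT, binder 1 (FH) calibration leaf IV — the free slab threshold of the barrier note is
# non-trivial: `p̂_c(q) < 1` for every `q ≥ 1`, `d ≥ 2` (free FK slab percolation `Π(p, 0)` at high density), with
# the Bernoulli sandwich `p̂_c(1) ≤ p̂_c(q) ≤ q·p̂_c(1)/(1 + (q-1)·p̂_c(1))` — so the slab window `(p̂_c(q), 1)` on which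
# leaf II (`fh_of_fkSlabCriticalProb_lt`, T1s-B) proves `FH` is non-empty for every `q`

Support file (`--supports stmt-CriticalPhenomena-4575`, helper) of the FRONTIER TRANSPLANT sub-cell
(`fk-continuity/transplant/`, seat `prim-bschramm-fkt-p2`); builds on p205010 (kernel theorem, internal audit signed;
external expert review pending). No definitions, no named facts, no sorries; standard axioms.
Registered R61 (cell INBOX l.4546, 2026-08-23); registry row T1t; lead label T1t-C = calibration leaf IV (fkt-lead L20, l.4550);
R61 (γ) applied (`rcCriticalProb_lt_one_of_slab` dropped) and R61 (α) exercised by the typer (L20: §FH dropped — no `FH`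
concluder in this file; the record file is not in its import cone).

HONEST FRAMING (page 1, cell rule). The transplant's theorem of record `ufsc0_of_freeBoundaryHypothesis_r3`
(p248245, « 2 / 0 ☑ ») is CONDITIONAL on FH AND on TP_FK = `KNFreeTargetHittable d q p`, both OPEN at the same `p`
for `q > 1` near `p_c(q)` (⇔ GRC Conj. (5.103) via K1; barrier note
`Literature.Barriers.CriticalPhenomena.SamePFreeBoundaryCriteria`, FBN-01, cited first: named fact
`Bodineau2005_slabThreshold`); the transplant is a typed reduction, not a proof of FK continuity. THIS FILE DOES NOT
CHANGE THAT. It is CALIBRATION leaf IV of binder 1 (companion of T1 `FHBernoulliWindow` = FH in the Bernoulli window,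
T1c `FHFreePercolation` = necessity `FH → 0 < θ⁰`, T1s `FHSlabPercolation` = sufficiency `Π(p, L) → FH` above the slab
threshold (leaf II), T1b `FHBoundaryReach` = `FH ⟺` free-box boundary reach (leaf III)): the slab threshold `p̂_c(q)` of FBN-01 (Grimmett 2006 (5.102)) is `< 1` for EVERY `q ≥ 1`, `d ≥ 2`, so
the general-`q` theorems of leaf II (`fh_of_fkSlabCriticalProb_lt`, `fh_of_fkSlabPercolation`) are NON-VACUOUS and
the K1 interval `[p_c(q), p̂_c(q)]` (whose collapse IS Conj. (5.103)) lies inside `[p_c(q), 1 - (C_d·q)⁻¹]`,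
`C_d = 2d·3^d·(8·3^d(3^d+1)²)^{2·3^d}`. This file
concludes NO `FH` (R61 (α), exercised by the typer L20: the `FH` corollaries are one-line compositions with leaf II by
name and are left to the reader; the record file `FreeBoundaryTransplantR3` is not in this file's import cone); NOT a
rule-5 discharge of binder 1, NOT a re-cut, NOT `_r4`, nothing about TP_FK, nothing at `p ↓ p_c(q)`; `_r3` « 2 / 0 ☑ »,
n_open = 2, BINDER-OWNERS, FO-19 NO-GO unchanged.

## What is proved

§1 `fkLaw_fkSlab_one_real_openConnIn`, `fkSlabConnectivity_one_right_eq` (at `q = 1` the free slab connectivity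
`φ⁰_{S(L,N),p,1}(0 ↔ x)` IS `P_p(0 ↔ x in S(L, N))`), `fkSlabConnectivity_ratio_one_le` / `fkSlabConnectivity_le_one_right`
((3.23)/(3.22) for the slab connectivities), `fkSlabPercolation_of_ratio_one` (`Π(p̃, L)` at `q = 1` ⟹ `Π(p, L)` at `q`,
`p̃ = p/(p + q(1-p))`), `fkSlabPercolation_one_of` (`Π(p, L)` at `q` ⟹ at `q = 1`).
§2 **`fkSlabPercolation_one_right_of_highDensity`** (Bernoulli `Π(p, 0)` with margin `1/2` for
`2d·3^d·(8·3^d(3^d+1)²)^{2·3^d}·(1-p) ≤ 1`, from the tools file's Peierls estimate `P_p(0 ↔ x in S(0,N)) ≥ 5/7`),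
**`fkSlabPercolation_of_highDensity`** (every `q ≥ 1`: `…·q·(1-p) ≤ 1 ⟹ Π(p, 0)`), `fkSlabCriticalProb_le_of_highDensity`,
`exists_fkSlabPercolation`, **`fkSlabCriticalProb_lt_one (hd : 2 ≤ d) (hq : 1 ≤ q) : fkSlabCriticalProb d q < 1`**
(with FBN-01's `p_c(q) ≤ p̂_c(q)` a slab-route re-derivation of the tree's `rcCriticalProb_lt_one`).
§3 `fkSlabCriticalProb_one_le` (`p̂_c(1) ≤ p̂_c(q)`), `fkSlabCriticalProb_le_threshold`
(`p̂_c(q) ≤ q·p̂_c(1)/(1 + (q-1)·p̂_c(1))`) — Grimmett's Thm. (5.5) mechanism for the slab thresholds.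
(With leaf II by name: `fh_of_fkSlabPercolation hd hq (fkSlabPercolation_of_highDensity …)` is `FH d q p` in the density
window, and `(p̂_c(q), 1) ≠ ∅` by `fkSlabCriticalProb_lt_one` — not typed here, R61 (α).)

Proof of §2 (Grimmett 2006 §5.7, "Clearly `p_c(q) ≤ p̂_c(q) < 1`", made explicit): in the thin slab `S(0, N)` (a
`(2N+1) × (2N+1)` square with `d - 2` frozen coordinates) a configuration not joining `0` to `x` has a closed
`★`-contour (`HDHit.exists_contour`) which stays within sup-distance `|Γ|` of `0` or of `x`
(`SlabHD.supDist_lt_card_of_separating`: two long directions let four coordinate segments bypass a small far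
contour), so Peierls' sum over anchored `★`-animals converges UNIFORMLY in `N` and `x`; the Bernoulli bound transfers
to `q ≥ 1` at the comparison density by (3.23).

## References

* G. Grimmett, *The Random-Cluster Model*, Springer 2006, Thm. (3.21) (3.22)–(3.23), Thm. (5.5) (5.8), §5.7
  (5.102)–(5.103) and proof of Thm. (5.104) [Grimmett2006].
* G. Grimmett, *Percolation*, 2nd ed. 1999, §1.4 (Peierls' argument) [GrimmettPercolation1999].
* F. Severo, arXiv:2312.06831 (2024), §1 (p̂_c) [Severo2024]; T. Bodineau, PTRF 2005, §2.2 [Bodineau2005].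
-/

noncomputable section

open scoped Classical
open MeasureTheory

namespace Summit.CriticalPhenomena.PercolationContinuityZ3.Theorems.FK

open Literature.Probability.Percolation Literature.Probability.LatticeModels SimpleGraph Finset
open Literature.Probability.Percolation.KozmaNitzan Literature.Barriers.CriticalPhenomena

variable {d : ℕ}

/-! ### 1. The comparison inequalities (3.22)/(3.23) for the slab connectivities and for `Π(p, L)` -/

/-- **(3.23) for the slab connectivities**: `φ⁰_{S,p̃,1}(0 ↔ x) ≤ φ⁰_{S,p,q}(0 ↔ x)`, `p̃ = p/(p + q(1-p))`, `q ≥ 1`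
(tree `rcMeasure_real_bernoulli_le` for the increasing event `{0 ↔ x in S}`). [cite: Grimmett2006, Thm. (3.21), eq. (3.23)] -/
theorem fkSlabConnectivity_ratio_one_le {p q : ℝ} (hp : p ∈ Set.Icc (0 : ℝ) 1) (hq : 1 ≤ q) (L N : ℕ)
    (x : FKSlabV d L N) : fkSlabConnectivity d (p / (p + q * (1 - p))) 1 L N x ≤ fkSlabConnectivity d p q L N x :=
  rcMeasure_real_bernoulli_le _ hp hq _ (isUpperSet_fkSlabJoined d L N x)

/-- **(3.22) for the slab connectivities**: `φ⁰_{S,p,q}(0 ↔ x) ≤ φ⁰_{S,p,1}(0 ↔ x)` for `q ≥ 1`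
(tree `rcMeasure_real_anti_right`). [cite: Grimmett2006, Thm. (3.21), eq. (3.22)] -/
theorem fkSlabConnectivity_le_one_right {p q : ℝ} (hp : p ∈ Set.Icc (0 : ℝ) 1) (hq : 1 ≤ q) (L N : ℕ)
    (x : FKSlabV d L N) : fkSlabConnectivity d p q L N x ≤ fkSlabConnectivity d p 1 L N x :=
  rcMeasure_real_anti_right _ hp le_rfl hq _ (isUpperSet_fkSlabJoined d L N x)

/-- **`Π(p̃, L)` at `q = 1` forces `Π(p, L)` at `q`** (`p̃ = p/(p + q(1-p))`, `q ≥ 1`): Bernoulli slab percolation at the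
comparison density gives free FK slab percolation, with the same margin `α`. [cite: Grimmett2006, Thm. (3.21), eq. (3.23); §5.7 (Π(p, L))] -/
theorem fkSlabPercolation_of_ratio_one {p q : ℝ} (hp : p ∈ Set.Icc (0 : ℝ) 1) (hq : 1 ≤ q) {L : ℕ}
    (h : FKSlabPercolation d (p / (p + q * (1 - p))) 1 L) : FKSlabPercolation d p q L := by
  obtain ⟨α, hα, hlt⟩ := h
  exact ⟨α, hα, fun N x => (hlt N x).trans_le (fkSlabConnectivity_ratio_one_le hp hq L N x)⟩

/-- **`Π(p, L)` at `q` forces `Π(p, L)` at `q = 1`** (`q ≥ 1`): free FK slab percolation gives Bernoulli slab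
percolation at the same density. [cite: Grimmett2006, Thm. (3.21), eq. (3.22); §5.7 (Π(p, L))] -/
theorem fkSlabPercolation_one_of {p q : ℝ} (hp : p ∈ Set.Icc (0 : ℝ) 1) (hq : 1 ≤ q) {L : ℕ}
    (h : FKSlabPercolation d p q L) : FKSlabPercolation d p 1 L := by
  obtain ⟨α, hα, hlt⟩ := h
  exact ⟨α, hα, fun N x => (hlt N x).trans_le (fkSlabConnectivity_le_one_right hp hq L N x)⟩

/-! ### 2. Free FK slab percolation in the thin slab `S(0, N)` at high density -/

/-- **Free FK slab percolation `Π(p, 0)` at high density, every `q ≥ 1`, `d ≥ 2`**: if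
`2d·3^d·(8·3^d(3^d+1)²)^{2·3^d}·q·(1 - p) ≤ 1` then `Π(p, 0)` holds for the free random-cluster measures with
cluster weight `q` (the Bernoulli case at the comparison density `p̃ = p/(p + q(1-p))`, `1 - p̃ ≤ q(1 - p)`, lifted
by (3.23)). [cite: Grimmett2006, §5.7 ("Clearly p_c(q) ≤ p̂_c(q) < 1") and Thm. (3.21), eq. (3.23)] -/
theorem fkSlabPercolation_of_highDensity (hd : 2 ≤ d) {q : ℝ} (hq : 1 ≤ q) (p : unitInterval)
    (hp : 2 * d * 3 ^ d * (8 * (3 ^ d * (3 ^ d + 1 : ℝ) ^ 2)) ^ (2 * 3 ^ d) * (q * (1 - (p : ℝ))) ≤ 1) :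
    FKSlabPercolation d p q 0 := by
  set p' : unitInterval := ⟨(p : ℝ) / (p + q * (1 - p)), ratio_mem_Icc p.2 hq⟩ with hp'
  have hp'v : (p' : ℝ) = (p : ℝ) / (p + q * (1 - p)) := rfl
  have h := fkSlabPercolation_of_ratio_one (d := d) (L := 0) p.2 hq
  rw [← hp'v] at h
  refine h (fkSlabPercolation_one_right_of_highDensity hd p' ?_)
  -- `1 - p̃ = q(1-p)/(p + q(1-p)) ≤ q(1-p)`
  have hden : 1 ≤ (p : ℝ) + q * (1 - p) := one_le_ratio_den p.2 hq
  have hq0 : 0 ≤ q * (1 - (p : ℝ)) := mul_nonneg (zero_le_one.trans hq) (sub_nonneg.2 p.2.2)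
  have h1 : 1 - (p' : ℝ) ≤ q * (1 - (p : ℝ)) := by
    have heq : 1 - (p' : ℝ) = q * (1 - (p : ℝ)) / (p + q * (1 - p)) := by
      rw [hp'v]; field_simp; ring
    rw [heq]
    exact div_le_self hq0 hden
  have hC : (0 : ℝ) ≤ 2 * d * 3 ^ d * (8 * (3 ^ d * (3 ^ d + 1 : ℝ) ^ 2)) ^ (2 * 3 ^ d) := by positivity
  exact (mul_le_mul_of_nonneg_left h1 hC).trans hp

/-- **`p̂_c(q) ≤ p` at high density**: under the density hypothesis of `fkSlabPercolation_of_highDensity`,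
`fkSlabCriticalProb d q ≤ p`. [cite: Grimmett2006, §5.7 eq. (5.102) ("Clearly p_c(q) ≤ p̂_c(q) < 1")] -/
theorem fkSlabCriticalProb_le_of_highDensity (hd : 2 ≤ d) {q : ℝ} (hq : 1 ≤ q) (p : unitInterval)
    (hp : 2 * d * 3 ^ d * (8 * (3 ^ d * (3 ^ d + 1 : ℝ) ^ 2)) ^ (2 * 3 ^ d) * (q * (1 - (p : ℝ))) ≤ 1) :
    fkSlabCriticalProb d q ≤ p :=
  fkSlabCriticalProb_le_of_fkSlabPercolation p.2 (fkSlabPercolation_of_highDensity hd hq p hp)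

/-- **Free FK slab percolation is satisfiable below `p = 1`** (`q ≥ 1`, `d ≥ 2`): `Π(p, 0)` holds at the explicit
density `p = 1 - (2d·3^d·(8·3^d(3^d+1)²)^{2·3^d}·q)⁻¹ < 1`. [cite: Grimmett2006, §5.7 ("Clearly p_c(q) ≤ p̂_c(q) < 1")] -/
theorem exists_fkSlabPercolation (hd : 2 ≤ d) {q : ℝ} (hq : 1 ≤ q) :
    ∃ p : unitInterval, (p : ℝ) < 1 ∧ FKSlabPercolation d p q 0 := by
  set C : ℝ := 2 * d * 3 ^ d * (8 * (3 ^ d * (3 ^ d + 1 : ℝ) ^ 2)) ^ (2 * 3 ^ d) * q with hC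
  have hd1 : (1 : ℝ) ≤ d := by exact_mod_cast (show 1 ≤ d by omega)
  have hC1 : 1 ≤ C := by
    rw [hC]
    have h3 : (1 : ℝ) ≤ 3 ^ d := one_le_pow₀ (by norm_num)
    have hA : (1 : ℝ) ≤ (3 ^ d + 1) ^ 2 := one_le_pow₀ (by linarith)
    have hK : (1 : ℝ) ≤ (8 * (3 ^ d * (3 ^ d + 1 : ℝ) ^ 2)) ^ (2 * 3 ^ d) := one_le_pow₀ (by nlinarith)
    have h2d : (1 : ℝ) ≤ 2 * d := by linarith
    exact one_le_mul_of_one_le_of_one_le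
      (one_le_mul_of_one_le_of_one_le (one_le_mul_of_one_le_of_one_le h2d h3) hK) hq
  have hC0 : 0 < C := by linarith
  have hmem : 1 - C⁻¹ ∈ Set.Icc (0 : ℝ) 1 := by
    constructor
    · rw [sub_nonneg]; exact inv_le_one_of_one_le₀ hC1
    · have := inv_pos.2 hC0; linarith
  refine ⟨⟨1 - C⁻¹, hmem⟩, by have := inv_pos.2 hC0; show 1 - C⁻¹ < 1; linarith, ?_⟩
  refine fkSlabPercolation_of_highDensity hd hq _ ?_
  show 2 * d * 3 ^ d * (8 * (3 ^ d * (3 ^ d + 1 : ℝ) ^ 2)) ^ (2 * 3 ^ d) * (q * (1 - (1 - C⁻¹))) ≤ 1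
  rw [sub_sub_cancel, ← mul_assoc, ← hC, mul_inv_cancel₀ hC0.ne']

/-- **The free slab threshold is non-trivial: `p̂_c(q) < 1` for every `q ≥ 1`, `d ≥ 2`** (Grimmett 2006, §5.7:
"Clearly `p_c(q) ≤ p̂_c(q) < 1`", here a theorem for the free random-cluster measures of the slab boxes). With FBN-01's
`rcCriticalProb_le_fkSlabCriticalProb` this re-derives the tree's `rcCriticalProb_lt_one` (`Theorems/FK/CriticalPointBounds`,
Grimmett (5.9)) by the slab route. [cite: Grimmett2006, §5.7 ("Clearly p_c(q) ≤ p̂_c(q) < 1")] -/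
theorem fkSlabCriticalProb_lt_one (hd : 2 ≤ d) {q : ℝ} (hq : 1 ≤ q) : fkSlabCriticalProb d q < 1 := by
  obtain ⟨p, hp1, hSP⟩ := exists_fkSlabPercolation hd hq
  exact (fkSlabCriticalProb_le_of_fkSlabPercolation p.2 hSP).trans_lt hp1

/-! ### 3. The Bernoulli sandwich of the slab threshold: `p̂_c(1) ≤ p̂_c(q) ≤ q·p̂_c(1)/(1 + (q-1)·p̂_c(1))` -/

/-- **`p̂_c(1) ≤ p̂_c(q)`** for `q ≥ 1` ((3.22): free FK slab percolation forces Bernoulli slab percolation at the same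
density). [cite: Grimmett2006, Thm. (3.21), eq. (3.22); §5.7 eq. (5.102)] -/
theorem fkSlabCriticalProb_one_le {q : ℝ} (hq : 1 ≤ q) : fkSlabCriticalProb d 1 ≤ fkSlabCriticalProb d q :=
  le_csInf ⟨1, one_mem_fkSlabCriticalSet (one_pos.trans_le hq)⟩
    fun _ ⟨hp, _, hL⟩ => fkSlabCriticalProb_le_of_fkSlabPercolation hp (fkSlabPercolation_one_of hp hq hL)

/-- **`p̂_c(q) ≤ q·p̂_c(1)/(1 + (q-1)·p̂_c(1))`** for `q ≥ 1` ((3.23): above the image of the Bernoulli slab threshold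
under `c ↦ q c/(1 + (q-1) c)` the comparison density exceeds `p̂_c(1)`, so Bernoulli slab percolation holds there and
lifts). With `fkSlabCriticalProb_one_le`: the free slab threshold of every `q ≥ 1` is pinned to the Bernoulli one by
the two comparison maps of Thm. (3.21), exactly as `p_c(q)` is pinned to `p_c(ℤ^d)` by (5.5).
[cite: Grimmett2006, Thm. (3.21), eq. (3.23); Thm. (5.5) (5.8); §5.7 eq. (5.102)] -/
theorem fkSlabCriticalProb_le_threshold {q : ℝ} (hq : 1 ≤ q) :
    fkSlabCriticalProb d q ≤
      q * fkSlabCriticalProb d 1 / (1 + (q - 1) * fkSlabCriticalProb d 1) := by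
  set c : ℝ := fkSlabCriticalProb d 1 with hc
  have hcI : c ∈ Set.Icc (0 : ℝ) 1 := fkSlabCriticalProb_mem_Icc one_pos
  refine le_of_forall_gt_imp_ge_of_dense fun p hp => ?_
  rcases le_or_gt p 1 with hp1 | hp1
  · have hp0 : 0 ≤ p := by
      have hden : 0 < 1 + (q - 1) * c := by nlinarith [hcI.1]
      exact (div_nonneg (mul_nonneg (zero_le_one.trans hq) hcI.1) hden.le).trans hp.le
    have hpI : p ∈ Set.Icc (0 : ℝ) 1 := ⟨hp0, hp1⟩
    have hlt : c < p / (p + q * (1 - p)) := (ratio_threshold_lt_iff hcI hpI hq).1 hp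
    obtain ⟨p', ⟨hp', L, hL⟩, hp'lt⟩ := exists_lt_of_csInf_lt ⟨1, one_mem_fkSlabCriticalSet one_pos⟩ hlt
    have hSP : FKSlabPercolation d (p / (p + q * (1 - p))) 1 L :=
      hL.mono hp' (ratio_mem_Icc hpI hq) hp'lt.le le_rfl
    exact fkSlabCriticalProb_le_of_fkSlabPercolation hpI (fkSlabPercolation_of_ratio_one hpI hq hSP)
  · exact (fkSlabCriticalProb_mem_Icc (d := d) (one_pos.trans_le hq)).2.trans hp1.le

end Summit.CriticalPhenomena.PercolationContinuityZ3.Theorems.FK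

end
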